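import Mathlib
import Summits.AnomalousDissipation.AnomalousDissipation.Theorems.SolenoidalFractalHomogenisationLagrangianStepW7EngineSpineAC
import HarnessLib

/-!
# K1L_D (stmt-AnomalousDissipation-27980), W7 ENGINE S1b — PERIOD STAGE: slot products, the slot-integral floor, monotone energies, finite-horizon profile
# (helper; `--supports stmt-AnomalousDissipation-27980 --as helper`)

The bookkeeping between the abstract slot step (`W7Slot.slot_step`: `E(t₁) ≤ exp(−∫ min(σ/(9/8), σ/(7/8)))·E(t₀)` per slot) and the decay profile
of `ClassDecayW` on a FINITE horizon `[0, T]` (the weak solution lives on `(0,T)` only; p5 g10's `profile_capped` assumes all periods):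
* `antitoneOn_of_ac_of_ae_deriv_nonpos` — an absolutely continuous energy with a.e. nonpositive derivative is antitone on the interval;
* `slot_product` — chaining per-slot contractions `E(τ_{s+1}) ≤ exp(−I_s)·E(τ_s)` over `s < k` gives `E(τ_k) ≤ exp(−Σ_{s<k} I_s)·E(τ_0)` (`E ≥ 0`);
* `slot_integral_lower` — the floor of the slot exponent: if `σ = ρ₀ := α·A² − β₀` pointwise (`0 ≤ α`, `0 ≤ β₀`, the slow coefficient below the
  fast rates), `∫_{t₀}^{t₁} A² = (t₁ − t₀)/3` (triangle) and `A` continuous, then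
  `∫_{t₀}^{t₁} min(σ/(9/8), σ/(7/8)) ≥ (8/27)·α·(t₁−t₀) − (8/7)·β₀·(t₁−t₀)`;
* `profile_capped_on` — FINITE-HORIZON form of p5's `profile_capped`: `E` antitone and `≥ 0` on `[t₀, T]`, per-period contraction `e^{−κ}` for every
  period inside `[t₀, T]` ⇒ `E t ≤ e·exp(−(min κ 1/P)(t − t₀))·E t₀` for all `t ∈ [t₀, T]`.
No definitions, no sorry.  W7 assembly owner: prover ad-sawtooth-k1loc-p1 g11.  NOT a proof of the crux / of AD; rung F-D1.A0.
[cite: BedrossianCotiZelati2017, §2 (hypocoercivity: per-period contraction ⇒ exponential profile)] [problem: turb]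
-/

set_option linter.dupNamespace false

namespace Summit.AnomalousDissipation.AnomalousDissipation.Theorems.SolenoidalFractalHomogenisation.LagrangianStep.W7Engine

open Set Real MeasureTheory intervalIntegral

/-! ## §1 Monotone energies -/

/-- An absolutely continuous function on `[a, b]` with a.e. nonpositive derivative is antitone on `[a, b]`.
[cite: BedrossianCotiZelati2017, §2] -/
theorem antitoneOn_of_ac_of_ae_deriv_nonpos {G g : ℝ → ℝ} {a b : ℝ} (hab : a ≤ b)
    (hG : AbsolutelyContinuousOnInterval G a b)
    (hGd : ∀ᵐ t, t ∈ uIcc a b → HasDerivAt G (g t) t) (hg : ∀ᵐ t, t ∈ uIcc a b → g t ≤ 0) :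
    AntitoneOn G (Icc a b) := by
  intro s hs t ht hst
  have hsub : uIcc s t ⊆ uIcc a b := by
    rw [uIcc_of_le hst, uIcc_of_le hab]; exact Icc_subset_Icc hs.1 ht.2
  exact le_of_ac_of_ae_deriv_nonpos hst (hG.mono hsub) (hGd.mono fun x hx hxI => hx (hsub hxI))
    (hg.mono fun x hx hxI => hx (hsub hxI))

/-! ## §2 Chaining slots -/

/-- Chaining per-slot contractions: `E(τ (s+1)) ≤ exp(−I s)·E(τ s)` for `s < k` and `0 ≤ E(τ 0)` give
`E(τ k) ≤ exp(−Σ_{s<k} I s)·E(τ 0)` (here `E s := E(τ s)`). [cite: BedrossianCotiZelati2017, §2] -/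
theorem slot_product {E : ℕ → ℝ} {I : ℕ → ℝ}
    (hstep : ∀ s, E (s + 1) ≤ Real.exp (-I s) * E s) :
    ∀ k, E k ≤ Real.exp (-(∑ s ∈ Finset.range k, I s)) * E 0 := by
  intro k
  induction k with
  | zero => simp
  | succ k ih =>
    calc E (k + 1) ≤ Real.exp (-I k) * E k := hstep k
      _ ≤ Real.exp (-I k) * (Real.exp (-(∑ s ∈ Finset.range k, I s)) * E 0) :=
          mul_le_mul_of_nonneg_left ih (Real.exp_pos _).le
      _ = Real.exp (-(∑ s ∈ Finset.range (k + 1), I s)) * E 0 := by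
          rw [Finset.sum_range_succ, ← mul_assoc, ← Real.exp_add]; ring_nf

/-! ## §3 The floor of the slot exponent -/

/-- **Floor of the slot exponent.**  If the rate of the slot step is the slow coefficient `σ = α·A² − β₀` (`0 ≤ α, β₀`), the envelope is
continuous with `∫_{t₀}^{t₁} A² = (t₁ − t₀)/3`, then `∫_{t₀}^{t₁} min(σ/(9/8), σ/(7/8)) ≥ (8/27)·α·(t₁−t₀) − (8/7)·β₀·(t₁−t₀)`
(on `{σ ≥ 0}` the integrand is `(8/9)σ`, on `{σ < 0}` it is `(8/7)σ ≥ (8/9)σ − (16/63)β₀`). [cite: BedrossianCotiZelati2017, §2] -/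
theorem slot_integral_lower {A : ℝ → ℝ} {α β₀ t₀ t₁ : ℝ} (ht : t₀ ≤ t₁) (hα : 0 ≤ α) (hβ : 0 ≤ β₀)
    (hAc : Continuous A) (hA2 : ∫ s in t₀..t₁, A s ^ 2 = (t₁ - t₀) / 3) :
    (8 / 27) * α * (t₁ - t₀) - (8 / 7) * β₀ * (t₁ - t₀)
      ≤ ∫ s in t₀..t₁, min ((α * A s ^ 2 - β₀) / (9 / 8)) ((α * A s ^ 2 - β₀) / (7 / 8)) := by
  -- pointwise: `min(σ/(9/8), σ/(7/8)) ≥ (8/9)(αA² − β₀) − (16/63)β₀`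
  have hpt : ∀ s, (8 / 9) * (α * A s ^ 2) - (8 / 9 + 16 / 63) * β₀
      ≤ min ((α * A s ^ 2 - β₀) / (9 / 8)) ((α * A s ^ 2 - β₀) / (7 / 8)) := by
    intro s
    have hA2s : 0 ≤ α * A s ^ 2 := mul_nonneg hα (sq_nonneg _)
    rcases le_or_gt 0 (α * A s ^ 2 - β₀) with h | h
    · rw [min_eq_left (by rw [div_le_div_iff₀ (by norm_num) (by norm_num)]; nlinarith)]
      rw [le_div_iff₀ (by norm_num)]
      nlinarith
    · rw [min_eq_right (by rw [div_le_div_iff₀ (by norm_num) (by norm_num)]; nlinarith)]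
      rw [le_div_iff₀ (by norm_num)]
      nlinarith
  have hcont : Continuous fun s => min ((α * A s ^ 2 - β₀) / (9 / 8)) ((α * A s ^ 2 - β₀) / (7 / 8)) :=
    (((continuous_const.mul (hAc.pow 2)).sub continuous_const).div_const _).min
      (((continuous_const.mul (hAc.pow 2)).sub continuous_const).div_const _)
  have hcont' : Continuous fun s => (8 / 9) * (α * A s ^ 2) - (8 / 9 + 16 / 63) * β₀ :=
    (continuous_const.mul (continuous_const.mul (hAc.pow 2))).sub continuous_const
  have hmono := intervalIntegral.integral_mono_on ht (hcont'.intervalIntegrable (μ := volume) t₀ t₁)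
    (hcont.intervalIntegrable (μ := volume) t₀ t₁) (fun s _ => hpt s)
  have hlhs : ∫ s in t₀..t₁, ((8 / 9) * (α * A s ^ 2) - (8 / 9 + 16 / 63) * β₀)
      = (8 / 9) * α * ((t₁ - t₀) / 3) - (8 / 9 + 16 / 63) * β₀ * (t₁ - t₀) := by
    have hi1 : IntervalIntegrable (fun s => (8 / 9) * (α * A s ^ 2)) volume t₀ t₁ :=
      (continuous_const.mul (continuous_const.mul (hAc.pow 2))).intervalIntegrable (μ := volume) t₀ t₁
    have hi2 : IntervalIntegrable (fun _ : ℝ => (8 / 9 + 16 / 63) * β₀) volume t₀ t₁ :=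
      continuous_const.intervalIntegrable (μ := volume) t₀ t₁
    have h1 := intervalIntegral.integral_sub hi1 hi2
    rw [h1, intervalIntegral.integral_const, smul_eq_mul, intervalIntegral.integral_const_mul,
      intervalIntegral.integral_const_mul, hA2]
    ring
  rw [hlhs] at hmono
  have e : (8 / 27) * α * (t₁ - t₀) - (8 / 7) * β₀ * (t₁ - t₀)
      = (8 / 9) * α * ((t₁ - t₀) / 3) - (8 / 9 + 16 / 63) * β₀ * (t₁ - t₀) := by ring
  rw [e]; exact hmono

/-- The slot floor under the extra cap `64·27·ε ≤ 7·q·dmin·T²` on the Young weight: with `α = εc²q/2`, `β₀ = 8ε²c²/(dmin T²)`,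
`(8/27)αT − (8/7)β₀T ≥ εc²qT/27`. [cite: BedrossianCotiZelati2017, §2] -/
theorem slot_floor_of_cap {ε c q dmin T : ℝ} (hε : 0 ≤ ε) (hq : 0 ≤ q) (hdmin : 0 < dmin) (hT : 0 < T)
    (c5 : 64 * 27 * ε ≤ 7 * q * dmin * T ^ 2) :
    ε * c ^ 2 * q * T / 27 ≤ (8 / 27) * (ε * c ^ 2 * q / 2) * T - (8 / 7) * (8 * ε ^ 2 * c ^ 2 / (dmin * T ^ 2)) * T := by
  have hc2 : 0 ≤ ε * c ^ 2 := mul_nonneg hε (sq_nonneg _)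
  -- `(8/7)·8ε²c²/(dmin T²)·T = (64/7)·ε·(εc²)/(dmin T) ≤ εc²qT/27`
  have key : (8 / 7) * (8 * ε ^ 2 * c ^ 2 / (dmin * T ^ 2)) * T ≤ ε * c ^ 2 * q * T / 27 := by
    rw [show (8 / 7) * (8 * ε ^ 2 * c ^ 2 / (dmin * T ^ 2)) * T = (64 * ε) * (ε * c ^ 2) / (7 * dmin * T) by
      field_simp; ring]
    rw [div_le_iff₀ (by positivity)]
    have h1 : (64 * ε) * (ε * c ^ 2) * 27 ≤ (7 * q * dmin * T ^ 2) * (ε * c ^ 2) := by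
      have := mul_le_mul_of_nonneg_right c5 hc2; linarith
    nlinarith [h1]
  have hX : 0 ≤ ε * c ^ 2 * q * T := by positivity
  linarith

/-! ## §4 The finite-horizon profile -/

/-- **Finite-horizon profile** (p5 g10's `profile_capped` on `[t₀, T]`): an energy that is antitone and nonnegative on `[t₀, T]` and contracts by
`e^{−κ}` over every period `[t₀ + jP, t₀ + (j+1)P] ⊆ [t₀, T]` satisfies `E t ≤ e·exp(−(min κ 1/P)(t − t₀))·E t₀` on `[t₀, T]`.
[cite: BedrossianCotiZelati2017, §2] -/
theorem profile_capped_on {E : ℝ → ℝ} {t₀ T P κ : ℝ} (hP : 0 < P) (hκ : 0 ≤ κ)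
    (hanti : AntitoneOn E (Icc t₀ T)) (hE : ∀ t ∈ Icc t₀ T, 0 ≤ E t)
    (hper : ∀ j : ℕ, t₀ + (j + 1) * P ≤ T → E (t₀ + (j + 1) * P) ≤ Real.exp (-κ) * E (t₀ + j * P))
    {t : ℝ} (ht : t ∈ Icc t₀ T) :
    E t ≤ Real.exp 1 * Real.exp (-(min κ 1 / P) * (t - t₀)) * E t₀ := by
  -- per-period induction inside the horizon
  have hiter : ∀ j : ℕ, t₀ + j * P ≤ T → E (t₀ + j * P) ≤ Real.exp (-(κ * j)) * E t₀ := by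
    intro j
    induction j with
    | zero => intro _; simp
    | succ j ih =>
      intro hj
      have hj' : t₀ + j * P ≤ T := by
        have : (j : ℝ) * P ≤ (j + 1) * P := by nlinarith
        push_cast at hj; linarith
      calc E (t₀ + (↑(j + 1)) * P) = E (t₀ + (j + 1) * P) := by push_cast; ring_nf
        _ ≤ Real.exp (-κ) * E (t₀ + j * P) := hper j (by push_cast at hj; exact hj)
        _ ≤ Real.exp (-κ) * (Real.exp (-(κ * j)) * E t₀) := mul_le_mul_of_nonneg_left (ih hj') (Real.exp_pos _).le
        _ = Real.exp (-(κ * ↑(j + 1))) * E t₀ := by rw [← mul_assoc, ← Real.exp_add]; push_cast; ring_nf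
  -- the integer part of `(t − t₀)/P`
  set j := ⌊(t - t₀) / P⌋₊ with hj
  have ht0 : 0 ≤ t - t₀ := by linarith [ht.1]
  have hjle : (j : ℝ) * P ≤ t - t₀ := by
    have := Nat.floor_le (div_nonneg ht0 hP.le); rw [← hj] at this
    calc (j : ℝ) * P ≤ (t - t₀) / P * P := mul_le_mul_of_nonneg_right this hP.le
      _ = t - t₀ := div_mul_cancel₀ _ hP.ne'
  have hjlt : t - t₀ < (j + 1) * P := by
    have := Nat.lt_floor_add_one ((t - t₀) / P); rw [← hj] at this
    calc t - t₀ = (t - t₀) / P * P := (div_mul_cancel₀ _ hP.ne').symm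
      _ < (j + 1) * P := mul_lt_mul_of_pos_right this hP
  have hjT : t₀ + j * P ≤ T := by linarith [ht.2]
  have h1 : E t ≤ E (t₀ + j * P) := hanti ⟨by nlinarith, hjT⟩ ht (by linarith)
  have h2 := hiter j hjT
  have hE0 : 0 ≤ E t₀ := hE t₀ ⟨le_rfl, by linarith [ht.1, ht.2]⟩
  -- `exp(−κ j) ≤ e · exp(−(min κ 1/P)(t − t₀))`
  have hm0 : 0 ≤ min κ 1 := le_min hκ zero_le_one
  have hmin : min κ 1 ≤ κ := min_le_left _ _
  have hm1 : min κ 1 ≤ 1 := min_le_right _ _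
  have h3 : Real.exp (-(κ * j)) ≤ Real.exp 1 * Real.exp (-(min κ 1 / P) * (t - t₀)) := by
    rw [← Real.exp_add]
    apply Real.exp_le_exp.2
    have hq : (min κ 1 / P) * (t - t₀) ≤ min κ 1 * (j + 1) := by
      rw [div_mul_eq_mul_div, div_le_iff₀ hP]
      have := mul_le_mul_of_nonneg_left hjlt.le hm0; linarith
    have : min κ 1 * (j : ℝ) ≤ κ * j := mul_le_mul_of_nonneg_right hmin (Nat.cast_nonneg _)
    nlinarith
  calc E t ≤ E (t₀ + j * P) := h1
    _ ≤ Real.exp (-(κ * j)) * E t₀ := h2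
    _ ≤ (Real.exp 1 * Real.exp (-(min κ 1 / P) * (t - t₀))) * E t₀ := mul_le_mul_of_nonneg_right h3 hE0
    _ = Real.exp 1 * Real.exp (-(min κ 1 / P) * (t - t₀)) * E t₀ := by ring

end Summit.AnomalousDissipation.AnomalousDissipation.Theorems.SolenoidalFractalHomogenisation.LagrangianStep.W7Engine
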